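import Literature.MathematicalPhysics.QuantumFieldTheory.Balaban1983to89.B9Eq326OperatorTowerFlatExplicit
import Literature.MathematicalPhysics.QuantumFieldTheory.Balaban1983to89.B9Eq382FormRelativeNearFlat

/-!
# `Balaban1983to89.B9Eq382FormRelativeNearFlatTower` — T. Bałaban, *Propagators for lattice gauge theories in a background field*, Commun. Math. Phys.
# **99** (1985) 389–434 [Balaban1985BackgroundPropagators] Thm 3.11 p. 416 (second half) with (3.82)–(3.86) p. 407 and [Balaban1984PropagatorsI] (1.69)
# p. 29, FOR THE `(n+1)`-LEVEL OPERATOR OF (3.26) WITH THE COMPOSITE AVERAGINGS (3.15)∕(3.19): **THE FORM-RELATIVE (KATO-TYPE) NEAR-FLAT STEP ONE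
# STOREY UP** — ne9-leaf-03's one-step `B9Eq382FormRelativeNearFlat` (R2′ STEP B7′ S1 + S4 of `t4/ROUTES-NE9.md`) PORTED to the tower letters
# `RofUk`, `QkW`, with the strong flat form of `B9Eq326OperatorTowerFlatExplicit` (γ(d,a), free of `m, L, η, c₀, c₁` and of the number of levels) as input

statement-level skeleton of published theorems with citation tags; proofs where landed; nothing here is a claim about the Yang–Mills mass gap

PDF held: `paper:balaban1985-cmp99-background-propagators` pp. 404–407, 416; [Balaban1984PropagatorsI] p. 29, 33 — through the tree's
`B9Eq382FormRelativeNearFlat` ∕ `B5Eq190FlatStrongFormTransfer` docstrings (verbatim there).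
THE PRINT (verbatim, p. 407 before (3.84)): *«Now let us consider the operator Δ_a. We will prove the following generalization of Lemma 1.2 [6]»*; p. 416
(proof of Thm 3.11): positivity of `Δ_a(U)` from the flat one by the regularity (3.35)–(3.37) via (3.86).  The tree runs this step in the QUADRATIC-FORM
sense ([B5] (1.69)'s three squares at `U` against the three squares at `1`), first order in the derivative letters.

WHY THIS FILE (cell context).  The pub-balaban NE9 chain's small-field coercivity at `k = n+1` levels (`B9Thm311SmallFieldCoercivityTower`, gen 83) is an
OPERATOR-norm near-flat step off a WEAK flat form with a compactness constant; ne9-leaf-03 (gen 62) replaced the one-step analogue by the FORM-relative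
step off b05's STRONG (1.90) (`B9Eq382FormRelativeNearFlat`), whose error terms carry one `‖η⁻¹‖` per derivative letter (so print's η-scaled window
makes them η-free) — the owner's W-14 kept the TOWER PORT.  With `B9Eq316TowerFlatIsOneStep` ∕ `B9Eq326OperatorTowerFlatExplicit` (this lineage, gen 84)
the strong flat form holds for the `(n+1)`-level operator with the SAME constant γ(d,a); THIS FILE is leaf-03's step one storey up, proof for proof (the
three-squares identity and the Kato step are letter-generic: `RofUk` is an `RLatticeK`, `QkW` a linear `Q` slot).

WHAT IS PROVED (sorry-free; 0 `def`; nothing of the papers asserted).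
* §2 `re_inner_principalOpK_eq` (`re⟨x, D*D(U)x⟩ = ‖D_Ux‖²` on the `(n+1)`-level torus), **`re_inner_laplaceAk_eq_three_sq`**: (1.69) at `U` for the
  `(n+1)`-level letters — `re⟨x, (D*D + D R_{n+1}(U) D* + aQ_{n+1}(U)†Q_{n+1}(U)) x⟩ = ‖D_Ux‖² + ‖R_{n+1}(U)D*_Ux‖² + a‖Q_{n+1}(U)x‖²`.
* §3 **`re_inner_laplaceAk_ge_flat_sub`**: the near-flat step with the letter defects DISPLAYED (`δ_D, δ_S, δ_R, δ_Q, M_Q` — `δ_R` for `R_{n+1}`, `δ_Q`∕`M_Q` for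
  `Q_{n+1}` against the flat tower with `B9Eq315QTowerFlat`'s inhabited data): `re⟨x, Δ^{(n+1)}_a(1)x⟩ − (δ_D‖D_1x‖² + (δ_S + δ_Sδ_R + 2δ_R + δ_R²)‖D*_1x‖² +
  (δ_D + δ_D² + δ_S + δ_Sδ_R + δ_S² + aδ_Q(2M_Q + δ_Q))‖x‖²) ≤ re⟨x, Δ^{(n+1)}_a(U)x⟩`.
* §4 **`re_inner_laplaceAk_ge_flat_sub_of_transport`**: `δ_D = 4√d‖η⁻¹‖εR`, `δ_S = √d‖η⁻¹‖εR` DISCHARGED from the transporter closeness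
  (`B9Eq373DerivativeRemainderL2`, generic in the torus).
* §5 **`strong_coercive_of_form_near_flat_tower_canonical`** ∕ **`coercive_of_form_near_flat_tower_canonical`**: along `c₁(ηL^{n+1})² = c₀L^{(n+1)d}`,
  `0 < ηL^{n+1} ≤ 1`: `(γ(d,a) − θ)·(‖D_1x‖² + ‖D*_1x‖² + ‖x‖²) ≤ re⟨x, Δ^{(n+1)}_a(U)x⟩` with leaf-03's `θ` (in `t = ‖η⁻¹‖εR`, `δ_R`, `δ_Q`, `M_Q`, `a`, `d`) —
  NO `‖η⁻¹‖²`, no volume, no block size, NO DEPENDENCE ON THE NUMBER OF LEVELS beyond the displayed letters.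
MODEL ∕ DECLARED READINGS.  (M1) as `B9Eq382FormRelativeNearFlat` one storey up (tower data of `B9Eq315QTower`, weights `c₀`∕`c₁`, scalar `η⁻¹`; `hRS`
displayed).  (M2) DISPLAYED letters: transporter closeness `εR`; `δ_R` for `R_{n+1}(U) − R_{n+1}(1)` (ne9-leaf-04's `B9Eq368RLipschitzTowerTwoBackgrounds` ∕
the S3 programme supply it, with their constants); `δ_Q`, `M_Q` for `Q_{n+1}` (`B9Eq315QTowerLipschitz[Profile]`, `B9Eq315QTowerFlatRightInverse`).  (M3) NOT
HERE: those letters; the curvature part `Δ′(U)`; the gauge step; print's sup-norm∕decay statements.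
HONEST SCOPE.  ne9-leaf-03's one-step file re-typed at the tower letters + this lineage's explicit flat constant BY NAME; [folklore] square algebra;
«NE9 ⇐ the named binders»; NE9 NOT PRINTED ∕ NOT PROVED; NOT summit progress (cell pub-balaban: row NE9 WALLED ON A MODEL; spine PROVED 0∕9; rung (B)+1
finite T⁴ — NOT infinite volume, NOT mass gap, NOT Clay; HONEST DEPENDENCY: continuum YM on T⁴ ⇐ BetaPertH ∧ nine spine estimates (0/9 proved); BetaPertH
⇐ (D1) ∧ (D4) ∧ CAP+tail; G-an2-4 gates asym, D1 and NE2/3/4).  Filed by the pub-balaban NE9 BINDER-row owner lineage `b2b-balaban-t4-ne9-p1` (gen 84),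
INTENT I-ne9p1-g84-4; NEW file importing `B9Eq326OperatorTowerFlatExplicit` + `B9Eq382FormRelativeNearFlat`; modifies nothing.  Net new unproved facts: 0.
-/

noncomputable section

open scoped BigOperators InnerProductSpace ComplexConjugate

namespace Literature.MathematicalPhysics.QuantumFieldTheory.Balaban1983to89.B9Eq382FormRelativeNearFlatTower

open B4Sect5Torus (TSite)
open B9SectCLatticeCarrier (Bond)
open B9Eq319QprimeTorus (fineP)
open B11Eq103H1Complex (SiteL2K BondL2K covDivL2K laplaceALatticeK adjoint_covDerivL2K)
open B9Eq310HessianOperator (adTransportW principalOpK covCurlL2K principalOpK_eq_comp inner_covCoCurlL2K_covCurlL2K)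
open B9Eq315QTorus (perCfg cornerSite)
open B9Eq315QTower (towerP UlevOf)
open B9Eq315QTowerFlat (perCfg_UlevOf_one_mem_U1 norm_Wcx_UlevOf_one_sub_one_le)
open B9Eq326OperatorTower (QkW RofUk)
open B7Prop1Explicit (U1 Wcx boxVec)
open B5Eq172HodgePositivity (conj_inv_ofReal laplaceALatticeK_RLatticeK_eq re_inner_laplaceAK_projR adTransportW_one adTransportW_inv_one hRS_one)
open B9Eq326OperatorTowerFlatExplicit (flat_strong_coercive_tower_canonical)
open B9Eq373DerivativeRemainderL2 (norm_covCurlL2K_sub_le norm_covDivL2K_sub_le)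
open B9Eq368ProjectionRemainder (norm_projR_le)
open B9Eq382FormRelativeNearFlat (norm_sq_sub_le)

/-- `2st ≤ s² + t²`. [folklore] -/
private theorem two_mul_le_sq_add_sq (s t : ℝ) : 2 * s * t ≤ s ^ 2 + t ^ 2 := by nlinarith [sq_nonneg (s - t)]

/-! ## §2 (1.69) AT the background `U`: the three squares of the chain's principal gauge-fixed form -/

section ThreeSquares

variable {d : ℕ} (L : ℕ) [NeZero L] (m : Fin d → ℕ) [∀ i, NeZero (m i)] (n : ℕ) (hL : 1 ≤ L) {c₀ c₁ : ℝ} [Fact (0 < c₀)] [Fact (0 < c₁)]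
  {𝔸 : Type*} [NormedRing 𝔸] [NormedAlgebra ℂ 𝔸] [CompleteSpace 𝔸] [NormOneClass 𝔸]
  {W : Type*} [NormedAddCommGroup W] [InnerProductSpace ℂ W] [FiniteDimensional ℂ W] (φ : W ≃ₗ[ℂ] 𝔸)
  (η : ℝ) (a : ℝ) (U : Bond d (towerP L m (n + 1)) → 𝔸ˣ) (α : ℕ → ℝ) (hα1 : ∀ j, α j ≤ 1 / 64)
  (hU1 : ∀ (j : ℕ) (x : B7Prop1Explicit.Site d) (κ : Fin d), perCfg (towerP L m (j + 1)) (UlevOf L m (n + 1) U j) x κ ∈ U1 𝔸)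
  (hreg : ∀ (j : ℕ) (y : TSite d (towerP L m j)) (κ : Fin d) (r : Fin d → Fin L),
    ‖((Wcx L (perCfg (towerP L m (j + 1)) (UlevOf L m (n + 1) U j)) (cornerSite L y) κ (boxVec L r) : 𝔸ˣ) : 𝔸) - 1‖ ≤ α j)
  (hRS : ∀ (b : Bond d (towerP L m (n + 1))) (v u : W), ⟪adTransportW φ U b v, u⟫_ℂ = ⟪v, adTransportW φ (fun b => (U b)⁻¹) b u⟫_ℂ)

include hRS

omit [NeZero L] [∀ i, NeZero (m i)] [CompleteSpace 𝔸] [NormOneClass 𝔸] in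
/-- **`re⟨x, D*D(U)x⟩ = ‖D_Ux‖²`** under the mutual adjointness `hRS` of the transporters read on the fibre (`B9Eq310HessianOperator.principalOpK_eq_comp`
+ `inner_covCoCurlL2K_covCurlL2K`); `B5Eq172HodgePositivity.re_inner_principalOpK_one` is the case `U = 1`. [cite: Balaban1985BackgroundPropagators, (3.10) p.392] -/
theorem re_inner_principalOpK_eq (x : BondL2K ℂ d (towerP L m (n + 1)) c₀ W) :
    RCLike.re ⟪x, principalOpK φ η U x⟫_ℂ = ‖covCurlL2K ℂ c₀ ((η : ℂ))⁻¹ (adTransportW φ U) x‖ ^ 2 := by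
  rw [principalOpK_eq_comp, LinearMap.comp_apply, inner_covCoCurlL2K_covCurlL2K _ (conj_inv_ofReal η) _ _ hRS, ← RCLike.ofReal_pow,
    RCLike.ofReal_re]

/-- **(1.69) AT THE BACKGROUND `U` — THREE SQUARES**: `re⟨x, (D*D + D R(U) D* + aQ(U)†Q(U)) x⟩ = ‖D_Ux‖² + ‖R(U)D*_Ux‖² + a‖Q(U)x‖²` for the
chain's letters at `U` (`B5Eq172HodgePositivity.laplaceALatticeK_RLatticeK_eq` + `re_inner_laplaceAK_projR`, `D* = D†` under `hRS`); (F)'s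
`re_inner_flat_eq_three_sq` is the case `U = 1`. [cite: Balaban1984PropagatorsI, (1.69) p.29; Balaban1985BackgroundPropagators, (3.10) p.392, (3.26) p.395] -/
theorem re_inner_laplaceAk_eq_three_sq (x : BondL2K ℂ d (towerP L m (n + 1)) c₀ W) :
    RCLike.re ⟪x, laplaceALatticeK ((η : ℂ))⁻¹ (adTransportW φ U) (adTransportW φ fun b => (U b)⁻¹) (principalOpK φ η U) (RofUk L m n φ η U)
        (QkW L m n φ U hL α hα1 hU1 hreg (c₁ := c₁)) a x⟫_ℂ =
      ‖covCurlL2K ℂ c₀ ((η : ℂ))⁻¹ (adTransportW φ U) x‖ ^ 2 +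
        ‖RofUk L m n φ η U (covDivL2K ℂ c₀ ((η : ℂ))⁻¹ (adTransportW φ fun b => (U b)⁻¹) x)‖ ^ 2 +
          a * ‖QkW L m n φ U hL α hα1 hU1 hreg (c₁ := c₁) x‖ ^ 2 := by
  have hc : conj (((η : ℂ))⁻¹) = ((η : ℂ))⁻¹ := conj_inv_ofReal η
  unfold RofUk
  rw [laplaceALatticeK_RLatticeK_eq _ hc _ _ hRS, re_inner_laplaceAK_projR, adjoint_covDerivL2K _ hc _ _ hRS, re_inner_principalOpK_eq L m n φ η U hRS]
  rfl

end ThreeSquares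

/-! ## §3 The form-relative near-flat step at the chain's letters (letter defects DISPLAYED) -/

section Near

variable {d : ℕ} (L : ℕ) [NeZero L] (m : Fin d → ℕ) [∀ i, NeZero (m i)] (n : ℕ) (hL : 1 ≤ L) {c₀ c₁ : ℝ} [Fact (0 < c₀)] [Fact (0 < c₁)]
  {𝔸 : Type*} [NormedRing 𝔸] [NormedAlgebra ℂ 𝔸] [CompleteSpace 𝔸] [NormOneClass 𝔸]
  {W : Type*} [NormedAddCommGroup W] [InnerProductSpace ℂ W] [FiniteDimensional ℂ W] (φ : W ≃ₗ[ℂ] 𝔸)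
  (η : ℝ) {a : ℝ} (ha : 0 ≤ a) (U : Bond d (towerP L m (n + 1)) → 𝔸ˣ) (α : ℕ → ℝ) (hα1 : ∀ j, α j ≤ 1 / 64)
  (hU1 : ∀ (j : ℕ) (x : B7Prop1Explicit.Site d) (κ : Fin d), perCfg (towerP L m (j + 1)) (UlevOf L m (n + 1) U j) x κ ∈ U1 𝔸)
  (hreg : ∀ (j : ℕ) (y : TSite d (towerP L m j)) (κ : Fin d) (r : Fin d → Fin L),
    ‖((Wcx L (perCfg (towerP L m (j + 1)) (UlevOf L m (n + 1) U j)) (cornerSite L y) κ (boxVec L r) : 𝔸ˣ) : 𝔸) - 1‖ ≤ α j)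
  (hRS : ∀ (b : Bond d (towerP L m (n + 1))) (v u : W), ⟪adTransportW φ U b v, u⟫_ℂ = ⟪v, adTransportW φ (fun b => (U b)⁻¹) b u⟫_ℂ)
  {δD δS δR δQ MQ : ℝ} (hδD : 0 ≤ δD) (hδS : 0 ≤ δS) (hδR : 0 ≤ δR) (hδQ : 0 ≤ δQ)
  (hD : ∀ x : BondL2K ℂ d (towerP L m (n + 1)) c₀ W, ‖covCurlL2K ℂ c₀ ((η : ℂ))⁻¹ (adTransportW φ U) x -
    covCurlL2K ℂ c₀ ((η : ℂ))⁻¹ (adTransportW φ (fun _ : Bond d (towerP L m (n + 1)) => (1 : 𝔸ˣ))) x‖ ≤ δD * ‖x‖)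
  (hS : ∀ x : BondL2K ℂ d (towerP L m (n + 1)) c₀ W, ‖covDivL2K ℂ c₀ ((η : ℂ))⁻¹ (adTransportW φ fun b => (U b)⁻¹) x -
    covDivL2K ℂ c₀ ((η : ℂ))⁻¹ (adTransportW φ fun _ : Bond d (towerP L m (n + 1)) => (1 : 𝔸ˣ)⁻¹) x‖ ≤ δS * ‖x‖)
  (hR : ∀ y : SiteL2K ℂ d (towerP L m (n + 1)) c₀ W, ‖RofUk L m n φ η U y - RofUk L m n φ η (fun _ : Bond d (towerP L m (n + 1)) => (1 : 𝔸ˣ)) y‖ ≤ δR * ‖y‖)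
  (hQ : ∀ x : BondL2K ℂ d (towerP L m (n + 1)) c₀ W, ‖QkW L m n φ U hL α hα1 hU1 hreg (c₁ := c₁) x -
    QkW L m n φ (fun _ : Bond d (towerP L m (n + 1)) => (1 : 𝔸ˣ)) hL (fun _ => 0) (fun _ => by norm_num) (perCfg_UlevOf_one_mem_U1 L m (n + 1)) (norm_Wcx_UlevOf_one_sub_one_le L m (n + 1) (fun _ => 0) (fun _ => le_rfl)) (c₁ := c₁) x‖ ≤ δQ * ‖x‖)
  (hQ₁ : ∀ x : BondL2K ℂ d (towerP L m (n + 1)) c₀ W,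
    ‖QkW L m n φ (fun _ : Bond d (towerP L m (n + 1)) => (1 : 𝔸ˣ)) hL (fun _ => 0) (fun _ => by norm_num) (perCfg_UlevOf_one_mem_U1 L m (n + 1)) (norm_Wcx_UlevOf_one_sub_one_le L m (n + 1) (fun _ => 0) (fun _ => le_rfl)) (c₁ := c₁) x‖ ≤ MQ * ‖x‖)

include ha hRS hδD hδS hδR hδQ hD hS hR hQ hQ₁

/-- **THE FORM-RELATIVE NEAR-FLAT STEP FOR THE NE9 CHAIN** ((3.84) ∕ p. 416's mechanism in the FORM sense): with the letter defects DISPLAYED —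
curl `δ_D`, divergence `δ_S`, projection `δ_R` (`‖(R(U) − R(1))y‖ ≤ δ_R‖y‖`), averaging `δ_Q` and the flat averaging norm `M_Q` —
`re⟨x, Δ_a(1)x⟩ − (δ_D·‖D_1x‖² + (δ_S + δ_Sδ_R + 2δ_R + δ_R²)·‖D*_1x‖² + (δ_D + δ_D² + δ_S + δ_Sδ_R + δ_S² + aδ_Q(2M_Q + δ_Q))·‖x‖²) ≤ re⟨x, Δ_a(U)x⟩`.
Proof: §2 at `U` and at `1`, `norm_sq_sub_le` on each square (`‖R(U)‖ ≤ 1`, `B9Eq368ProjectionRemainder.norm_projR_le`), `2st ≤ s² + t²`.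
FIRST order in the derivative letters: no `D*D` difference enters. [cite: Balaban1985BackgroundPropagators, (3.82)–(3.86) p.407, Thm 3.11 p.416; Balaban1984PropagatorsI, (1.69) p.29] -/
theorem re_inner_laplaceAk_ge_flat_sub (x : BondL2K ℂ d (towerP L m (n + 1)) c₀ W) :
    RCLike.re ⟪x, laplaceALatticeK ((η : ℂ))⁻¹ (adTransportW φ (fun _ : Bond d (towerP L m (n + 1)) => (1 : 𝔸ˣ)))
          (adTransportW φ fun _ : Bond d (towerP L m (n + 1)) => (1 : 𝔸ˣ)⁻¹) (principalOpK φ η fun _ => 1) (RofUk L m n φ η fun _ => 1)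
          (QkW L m n φ (fun _ : Bond d (towerP L m (n + 1)) => (1 : 𝔸ˣ)) hL (fun _ => 0) (fun _ => by norm_num) (perCfg_UlevOf_one_mem_U1 L m (n + 1)) (norm_Wcx_UlevOf_one_sub_one_le L m (n + 1) (fun _ => 0) (fun _ => le_rfl)) (c₁ := c₁)) a x⟫_ℂ -
        (δD * ‖covCurlL2K ℂ c₀ ((η : ℂ))⁻¹ (adTransportW φ (fun _ : Bond d (towerP L m (n + 1)) => (1 : 𝔸ˣ))) x‖ ^ 2 +
          (δS + δS * δR + 2 * δR + δR ^ 2) *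
            ‖covDivL2K ℂ c₀ ((η : ℂ))⁻¹ (adTransportW φ fun _ : Bond d (towerP L m (n + 1)) => (1 : 𝔸ˣ)⁻¹) x‖ ^ 2 +
          (δD + δD ^ 2 + δS + δS * δR + δS ^ 2 + a * δQ * (2 * MQ + δQ)) * ‖x‖ ^ 2) ≤
      RCLike.re ⟪x, laplaceALatticeK ((η : ℂ))⁻¹ (adTransportW φ U) (adTransportW φ fun b => (U b)⁻¹) (principalOpK φ η U) (RofUk L m n φ η U)
        (QkW L m n φ U hL α hα1 hU1 hreg (c₁ := c₁)) a x⟫_ℂ := by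
  rw [re_inner_laplaceAk_eq_three_sq L m n hL φ η a U α hα1 hU1 hreg hRS x,
    re_inner_laplaceAk_eq_three_sq L m n hL φ η a _ (fun _ => 0) (fun _ => by norm_num) (perCfg_UlevOf_one_mem_U1 L m (n + 1))
      (norm_Wcx_UlevOf_one_sub_one_le L m (n + 1) (fun _ => 0) (fun _ => le_rfl)) (hRS_one φ) x]
  -- names for the six vectors
  set cU := covCurlL2K ℂ c₀ ((η : ℂ))⁻¹ (adTransportW φ U) x with hcU
  set c1 := covCurlL2K ℂ c₀ ((η : ℂ))⁻¹ (adTransportW φ (fun _ : Bond d (towerP L m (n + 1)) => (1 : 𝔸ˣ))) x with hc1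
  set sU := covDivL2K ℂ c₀ ((η : ℂ))⁻¹ (adTransportW φ fun b => (U b)⁻¹) x with hsU
  set s1 := covDivL2K ℂ c₀ ((η : ℂ))⁻¹ (adTransportW φ fun _ : Bond d (towerP L m (n + 1)) => (1 : 𝔸ˣ)⁻¹) x with hs1
  set qU := QkW L m n φ U hL α hα1 hU1 hreg (c₁ := c₁) x with hqU
  set q1 := QkW L m n φ (fun _ : Bond d (towerP L m (n + 1)) => (1 : 𝔸ˣ)) hL (fun _ => 0) (fun _ => by norm_num) (perCfg_UlevOf_one_mem_U1 L m (n + 1)) (norm_Wcx_UlevOf_one_sub_one_le L m (n + 1) (fun _ => 0) (fun _ => le_rfl)) (c₁ := c₁) x with hq1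
  -- the curl square
  have hcurl : ‖c1‖ ^ 2 - ‖cU‖ ^ 2 ≤ δD * ‖x‖ * (2 * ‖c1‖ + δD * ‖x‖) := by
    have h := norm_sq_sub_le cU c1
    have hd : ‖cU - c1‖ ≤ δD * ‖x‖ := hD x
    have h0 : 0 ≤ ‖cU - c1‖ := norm_nonneg _
    calc ‖c1‖ ^ 2 - ‖cU‖ ^ 2 ≤ ‖cU - c1‖ * (2 * ‖c1‖ + ‖cU - c1‖) := h
      _ ≤ δD * ‖x‖ * (2 * ‖c1‖ + δD * ‖x‖) := mul_le_mul hd (by linarith) (by positivity) (by positivity)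
  -- the projected-divergence square: `‖R_U s_U − R_1 s_1‖ ≤ ‖s_U − s_1‖ + ‖(R_U − R_1)s_1‖ ≤ δ_S‖x‖ + δ_R‖s_1‖`, `‖R_1 s_1‖ ≤ ‖s_1‖`
  have hRU1 : ‖RofUk L m n φ η U sU - RofUk L m n φ η (fun _ : Bond d (towerP L m (n + 1)) => (1 : 𝔸ˣ)) s1‖ ≤ δS * ‖x‖ + δR * ‖s1‖ := by
    have hsplit : RofUk L m n φ η U sU - RofUk L m n φ η (fun _ : Bond d (towerP L m (n + 1)) => (1 : 𝔸ˣ)) s1 =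
        RofUk L m n φ η U (sU - s1) + (RofUk L m n φ η U s1 - RofUk L m n φ η (fun _ : Bond d (towerP L m (n + 1)) => (1 : 𝔸ˣ)) s1) := by
      rw [map_sub]; abel
    rw [hsplit]
    refine (norm_add_le _ _).trans (add_le_add ?_ (hR s1))
    exact (norm_projR_le _ _ _).trans (hS x)
  have hR1le : ‖RofUk L m n φ η (fun _ : Bond d (towerP L m (n + 1)) => (1 : 𝔸ˣ)) s1‖ ≤ ‖s1‖ := norm_projR_le _ _ _
  have hproj : ‖RofUk L m n φ η (fun _ : Bond d (towerP L m (n + 1)) => (1 : 𝔸ˣ)) s1‖ ^ 2 - ‖RofUk L m n φ η U sU‖ ^ 2 ≤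
      (δS * ‖x‖ + δR * ‖s1‖) * (2 * ‖s1‖ + (δS * ‖x‖ + δR * ‖s1‖)) := by
    have h := norm_sq_sub_le (RofUk L m n φ η U sU) (RofUk L m n φ η (fun _ : Bond d (towerP L m (n + 1)) => (1 : 𝔸ˣ)) s1)
    have h0 : 0 ≤ ‖RofUk L m n φ η U sU - RofUk L m n φ η (fun _ : Bond d (towerP L m (n + 1)) => (1 : 𝔸ˣ)) s1‖ := norm_nonneg _
    refine h.trans (mul_le_mul hRU1 (by linarith) (by positivity) (by positivity))
  -- the averaging square
  have havg : ‖q1‖ ^ 2 - ‖qU‖ ^ 2 ≤ δQ * ‖x‖ * (2 * (MQ * ‖x‖) + δQ * ‖x‖) := by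
    have h := norm_sq_sub_le qU q1
    have hd : ‖qU - q1‖ ≤ δQ * ‖x‖ := hQ x
    have h0 : 0 ≤ ‖qU - q1‖ := norm_nonneg _
    have hq : ‖q1‖ ≤ MQ * ‖x‖ := hQ₁ x
    refine h.trans (mul_le_mul hd (by linarith) (by positivity) (by positivity))
  -- Young on the cross terms and bookkeeping
  have hy1 := two_mul_le_sq_add_sq ‖x‖ ‖c1‖
  have hy2 := two_mul_le_sq_add_sq ‖x‖ ‖s1‖
  have havg' : a * (‖q1‖ ^ 2 - ‖qU‖ ^ 2) ≤ a * (δQ * ‖x‖ * (2 * (MQ * ‖x‖) + δQ * ‖x‖)) := mul_le_mul_of_nonneg_left havg ha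
  have p1 : δD * (2 * ‖x‖ * ‖c1‖) ≤ δD * (‖x‖ ^ 2 + ‖c1‖ ^ 2) := mul_le_mul_of_nonneg_left hy1 hδD
  have p2 : δS * (2 * ‖x‖ * ‖s1‖) ≤ δS * (‖x‖ ^ 2 + ‖s1‖ ^ 2) := mul_le_mul_of_nonneg_left hy2 hδS
  have p3 : δS * δR * (2 * ‖x‖ * ‖s1‖) ≤ δS * δR * (‖x‖ ^ 2 + ‖s1‖ ^ 2) := mul_le_mul_of_nonneg_left hy2 (mul_nonneg hδS hδR)
  -- linear bookkeeping in the monomials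
  have hcurl' : ‖c1‖ ^ 2 - ‖cU‖ ^ 2 ≤ δD * ‖c1‖ ^ 2 + (δD + δD ^ 2) * ‖x‖ ^ 2 := by
    have e1 : δD * ‖x‖ * (2 * ‖c1‖ + δD * ‖x‖) = δD * (2 * ‖x‖ * ‖c1‖) + δD ^ 2 * ‖x‖ ^ 2 := by ring
    have e2 : δD * (‖x‖ ^ 2 + ‖c1‖ ^ 2) = δD * ‖c1‖ ^ 2 + δD * ‖x‖ ^ 2 := by ring
    linarith [hcurl, p1, e1, e2]
  have hproj' : ‖RofUk L m n φ η (fun _ : Bond d (towerP L m (n + 1)) => (1 : 𝔸ˣ)) s1‖ ^ 2 - ‖RofUk L m n φ η U sU‖ ^ 2 ≤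
      (δS + δS * δR + 2 * δR + δR ^ 2) * ‖s1‖ ^ 2 + (δS + δS * δR + δS ^ 2) * ‖x‖ ^ 2 := by
    have e1 : (δS * ‖x‖ + δR * ‖s1‖) * (2 * ‖s1‖ + (δS * ‖x‖ + δR * ‖s1‖)) =
        δS * (2 * ‖x‖ * ‖s1‖) + δS * δR * (2 * ‖x‖ * ‖s1‖) + δS ^ 2 * ‖x‖ ^ 2 + (2 * δR + δR ^ 2) * ‖s1‖ ^ 2 := by ring
    have e2 : (δS + δS * δR + 2 * δR + δR ^ 2) * ‖s1‖ ^ 2 + (δS + δS * δR + δS ^ 2) * ‖x‖ ^ 2 =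
        δS * (‖x‖ ^ 2 + ‖s1‖ ^ 2) + δS * δR * (‖x‖ ^ 2 + ‖s1‖ ^ 2) + δS ^ 2 * ‖x‖ ^ 2 + (2 * δR + δR ^ 2) * ‖s1‖ ^ 2 := by ring
    linarith [hproj, p2, p3, e1, e2]
  have havg'' : a * ‖q1‖ ^ 2 - a * ‖qU‖ ^ 2 ≤ a * δQ * (2 * MQ + δQ) * ‖x‖ ^ 2 := by
    have e1 : a * (δQ * ‖x‖ * (2 * (MQ * ‖x‖) + δQ * ‖x‖)) = a * δQ * (2 * MQ + δQ) * ‖x‖ ^ 2 := by ring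
    have e2 : a * (‖q1‖ ^ 2 - ‖qU‖ ^ 2) = a * ‖q1‖ ^ 2 - a * ‖qU‖ ^ 2 := by ring
    linarith [havg', e1, e2]
  have e3 : (δD + δD ^ 2 + δS + δS * δR + δS ^ 2 + a * δQ * (2 * MQ + δQ)) * ‖x‖ ^ 2 =
      (δD + δD ^ 2) * ‖x‖ ^ 2 + (δS + δS * δR + δS ^ 2) * ‖x‖ ^ 2 + a * δQ * (2 * MQ + δQ) * ‖x‖ ^ 2 := by ring
  linarith [hcurl', hproj', havg'', e3]

end Near

/-! ## §4 The derivative defects DISCHARGED from the transporter closeness: `δ_D = 4√d‖η⁻¹‖εR`, `δ_S = √d‖η⁻¹‖εR` (first order, one `‖η⁻¹‖`) -/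

section Transport

variable {d : ℕ} (L : ℕ) [NeZero L] (m : Fin d → ℕ) [∀ i, NeZero (m i)] (n : ℕ) (hL : 1 ≤ L) {c₀ c₁ : ℝ} [Fact (0 < c₀)] [Fact (0 < c₁)]
  {𝔸 : Type*} [NormedRing 𝔸] [NormedAlgebra ℂ 𝔸] [CompleteSpace 𝔸] [NormOneClass 𝔸]
  {W : Type*} [NormedAddCommGroup W] [InnerProductSpace ℂ W] [FiniteDimensional ℂ W] (φ : W ≃ₗ[ℂ] 𝔸)
  (η : ℝ) {a : ℝ} (ha : 0 ≤ a) (U : Bond d (towerP L m (n + 1)) → 𝔸ˣ) (α : ℕ → ℝ) (hα1 : ∀ j, α j ≤ 1 / 64)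
  (hU1 : ∀ (j : ℕ) (x : B7Prop1Explicit.Site d) (κ : Fin d), perCfg (towerP L m (j + 1)) (UlevOf L m (n + 1) U j) x κ ∈ U1 𝔸)
  (hreg : ∀ (j : ℕ) (y : TSite d (towerP L m j)) (κ : Fin d) (r : Fin d → Fin L),
    ‖((Wcx L (perCfg (towerP L m (j + 1)) (UlevOf L m (n + 1) U j)) (cornerSite L y) κ (boxVec L r) : 𝔸ˣ) : 𝔸) - 1‖ ≤ α j)
  (hRS : ∀ (b : Bond d (towerP L m (n + 1))) (v u : W), ⟪adTransportW φ U b v, u⟫_ℂ = ⟪v, adTransportW φ (fun b => (U b)⁻¹) b u⟫_ℂ)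
  {εR δR δQ MQ : ℝ} (hεR : 0 ≤ εR) (hδR : 0 ≤ δR) (hδQ : 0 ≤ δQ)
  (hRε : ∀ (b : Bond d (towerP L m (n + 1))) (w : W), ‖adTransportW φ U b w - w‖ ≤ εR * ‖w‖)
  (hR : ∀ y : SiteL2K ℂ d (towerP L m (n + 1)) c₀ W, ‖RofUk L m n φ η U y - RofUk L m n φ η (fun _ : Bond d (towerP L m (n + 1)) => (1 : 𝔸ˣ)) y‖ ≤ δR * ‖y‖)
  (hQ : ∀ x : BondL2K ℂ d (towerP L m (n + 1)) c₀ W, ‖QkW L m n φ U hL α hα1 hU1 hreg (c₁ := c₁) x -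
    QkW L m n φ (fun _ : Bond d (towerP L m (n + 1)) => (1 : 𝔸ˣ)) hL (fun _ => 0) (fun _ => by norm_num) (perCfg_UlevOf_one_mem_U1 L m (n + 1)) (norm_Wcx_UlevOf_one_sub_one_le L m (n + 1) (fun _ => 0) (fun _ => le_rfl)) (c₁ := c₁) x‖ ≤ δQ * ‖x‖)
  (hQ₁ : ∀ x : BondL2K ℂ d (towerP L m (n + 1)) c₀ W,
    ‖QkW L m n φ (fun _ : Bond d (towerP L m (n + 1)) => (1 : 𝔸ˣ)) hL (fun _ => 0) (fun _ => by norm_num) (perCfg_UlevOf_one_mem_U1 L m (n + 1)) (norm_Wcx_UlevOf_one_sub_one_le L m (n + 1) (fun _ => 0) (fun _ => le_rfl)) (c₁ := c₁) x‖ ≤ MQ * ‖x‖)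

include ha hRS hεR hδR hδQ hRε hR hQ hQ₁

/-- **§3 WITH THE DERIVATIVE DEFECTS DISCHARGED** from the transporter closeness `‖R(U(b))w − w‖ ≤ εR‖w‖` (displayed; (C2) derives `εR = K_R·ε`):
`δ_D = 4√d·‖η⁻¹‖·εR` (`B9Eq373DerivativeRemainderL2.norm_covCurlL2K_sub_le`), `δ_S = √d·‖η⁻¹‖·εR` (`norm_covDivL2K_sub_le`) — ONE `‖η⁻¹‖` each, so
at print's η-scaled window (`εR = K_R·αη`) both are η-FREE (`4√dK_Rα`, `√dK_Rα`); `δ_R`, `δ_Q`, `M_Q` stay displayed.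
[cite: Balaban1985BackgroundPropagators, (3.70)–(3.73) pp.404–405, (3.82)–(3.86) p.407, Thm 3.11 p.416] -/
theorem re_inner_laplaceAk_ge_flat_sub_of_transport (x : BondL2K ℂ d (towerP L m (n + 1)) c₀ W) :
    RCLike.re ⟪x, laplaceALatticeK ((η : ℂ))⁻¹ (adTransportW φ (fun _ : Bond d (towerP L m (n + 1)) => (1 : 𝔸ˣ)))
          (adTransportW φ fun _ : Bond d (towerP L m (n + 1)) => (1 : 𝔸ˣ)⁻¹) (principalOpK φ η fun _ => 1) (RofUk L m n φ η fun _ => 1)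
          (QkW L m n φ (fun _ : Bond d (towerP L m (n + 1)) => (1 : 𝔸ˣ)) hL (fun _ => 0) (fun _ => by norm_num) (perCfg_UlevOf_one_mem_U1 L m (n + 1)) (norm_Wcx_UlevOf_one_sub_one_le L m (n + 1) (fun _ => 0) (fun _ => le_rfl)) (c₁ := c₁)) a x⟫_ℂ -
        ((4 * Real.sqrt d * (‖((η : ℂ))⁻¹‖ * εR)) * ‖covCurlL2K ℂ c₀ ((η : ℂ))⁻¹ (adTransportW φ (fun _ : Bond d (towerP L m (n + 1)) => (1 : 𝔸ˣ))) x‖ ^ 2 +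
          ((‖((η : ℂ))⁻¹‖ * εR * Real.sqrt d) + (‖((η : ℂ))⁻¹‖ * εR * Real.sqrt d) * δR + 2 * δR + δR ^ 2) *
            ‖covDivL2K ℂ c₀ ((η : ℂ))⁻¹ (adTransportW φ fun _ : Bond d (towerP L m (n + 1)) => (1 : 𝔸ˣ)⁻¹) x‖ ^ 2 +
          ((4 * Real.sqrt d * (‖((η : ℂ))⁻¹‖ * εR)) + (4 * Real.sqrt d * (‖((η : ℂ))⁻¹‖ * εR)) ^ 2 + (‖((η : ℂ))⁻¹‖ * εR * Real.sqrt d) +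
              (‖((η : ℂ))⁻¹‖ * εR * Real.sqrt d) * δR + (‖((η : ℂ))⁻¹‖ * εR * Real.sqrt d) ^ 2 + a * δQ * (2 * MQ + δQ)) * ‖x‖ ^ 2) ≤
      RCLike.re ⟪x, laplaceALatticeK ((η : ℂ))⁻¹ (adTransportW φ U) (adTransportW φ fun b => (U b)⁻¹) (principalOpK φ η U) (RofUk L m n φ η U)
        (QkW L m n φ U hL α hα1 hU1 hreg (c₁ := c₁)) a x⟫_ℂ := by
  have hc : conj (((η : ℂ))⁻¹) = ((η : ℂ))⁻¹ := conj_inv_ofReal η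
  have hR₁ : ∀ (b : Bond d (towerP L m (n + 1))) (w : W), adTransportW φ (fun _ : Bond d (towerP L m (n + 1)) => (1 : 𝔸ˣ)) b w = w := fun b w => by
    rw [adTransportW_one]; rfl
  have hS₁ : ∀ (b : Bond d (towerP L m (n + 1))) (w : W), adTransportW φ (fun _ : Bond d (towerP L m (n + 1)) => (1 : 𝔸ˣ)⁻¹) b w = w := fun b w => by
    rw [adTransportW_inv_one]; rfl
  have hD : ∀ y : BondL2K ℂ d (towerP L m (n + 1)) c₀ W, ‖covCurlL2K ℂ c₀ ((η : ℂ))⁻¹ (adTransportW φ U) y -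
      covCurlL2K ℂ c₀ ((η : ℂ))⁻¹ (adTransportW φ (fun _ : Bond d (towerP L m (n + 1)) => (1 : 𝔸ˣ))) y‖ ≤ (4 * Real.sqrt d * (‖((η : ℂ))⁻¹‖ * εR)) * ‖y‖ :=
    fun y => norm_covCurlL2K_sub_le _ hεR hRε hR₁ y
  have hSd : ∀ y : BondL2K ℂ d (towerP L m (n + 1)) c₀ W, ‖covDivL2K ℂ c₀ ((η : ℂ))⁻¹ (adTransportW φ fun b => (U b)⁻¹) y -
      covDivL2K ℂ c₀ ((η : ℂ))⁻¹ (adTransportW φ fun _ : Bond d (towerP L m (n + 1)) => (1 : 𝔸ˣ)⁻¹) y‖ ≤ (‖((η : ℂ))⁻¹‖ * εR * Real.sqrt d) * ‖y‖ :=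
    fun y => norm_covDivL2K_sub_le _ hc hεR hRε hR₁ hRS hS₁ y
  exact re_inner_laplaceAk_ge_flat_sub L m n hL φ η ha U α hα1 hU1 hreg hRS (by positivity) (by positivity) hδR hδQ hD hSd hR hQ hQ₁ x

end Transport

/-! ## §5 Composition with (S0): STRONG coercivity at `U` along Bałaban's normalisation, form-relative -/

section Strong

variable {d : ℕ} (L : ℕ) [NeZero L] (m : Fin d → ℕ) [∀ i, NeZero (m i)] (n : ℕ) (hL : 1 ≤ L) {c₀ c₁ : ℝ} [Fact (0 < c₀)] [Fact (0 < c₁)]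
  {𝔸 : Type*} [NormedRing 𝔸] [NormedAlgebra ℂ 𝔸] [CompleteSpace 𝔸] [NormOneClass 𝔸]
  {W : Type*} [NormedAddCommGroup W] [InnerProductSpace ℂ W] [FiniteDimensional ℂ W] (φ : W ≃ₗ[ℂ] 𝔸)
  {η : ℝ} {a : ℝ} (ha : 0 < a) (U : Bond d (towerP L m (n + 1)) → 𝔸ˣ) (α : ℕ → ℝ) (hα1 : ∀ j, α j ≤ 1 / 64)
  (hU1 : ∀ (j : ℕ) (x : B7Prop1Explicit.Site d) (κ : Fin d), perCfg (towerP L m (j + 1)) (UlevOf L m (n + 1) U j) x κ ∈ U1 𝔸)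
  (hreg : ∀ (j : ℕ) (y : TSite d (towerP L m j)) (κ : Fin d) (r : Fin d → Fin L),
    ‖((Wcx L (perCfg (towerP L m (j + 1)) (UlevOf L m (n + 1) U j)) (cornerSite L y) κ (boxVec L r) : 𝔸ˣ) : 𝔸) - 1‖ ≤ α j)
  (hRS : ∀ (b : Bond d (towerP L m (n + 1))) (v u : W), ⟪adTransportW φ U b v, u⟫_ℂ = ⟪v, adTransportW φ (fun b => (U b)⁻¹) b u⟫_ℂ)
  {εR δR δQ MQ : ℝ} (hεR : 0 ≤ εR) (hδR : 0 ≤ δR) (hδQ : 0 ≤ δQ) (hMQ : 0 ≤ MQ)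
  (hRε : ∀ (b : Bond d (towerP L m (n + 1))) (w : W), ‖adTransportW φ U b w - w‖ ≤ εR * ‖w‖)
  (hR : ∀ y : SiteL2K ℂ d (towerP L m (n + 1)) c₀ W, ‖RofUk L m n φ η U y - RofUk L m n φ η (fun _ : Bond d (towerP L m (n + 1)) => (1 : 𝔸ˣ)) y‖ ≤ δR * ‖y‖)
  (hQ : ∀ x : BondL2K ℂ d (towerP L m (n + 1)) c₀ W, ‖QkW L m n φ U hL α hα1 hU1 hreg (c₁ := c₁) x -
    QkW L m n φ (fun _ : Bond d (towerP L m (n + 1)) => (1 : 𝔸ˣ)) hL (fun _ => 0) (fun _ => by norm_num) (perCfg_UlevOf_one_mem_U1 L m (n + 1)) (norm_Wcx_UlevOf_one_sub_one_le L m (n + 1) (fun _ => 0) (fun _ => le_rfl)) (c₁ := c₁) x‖ ≤ δQ * ‖x‖)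
  (hQ₁ : ∀ x : BondL2K ℂ d (towerP L m (n + 1)) c₀ W,
    ‖QkW L m n φ (fun _ : Bond d (towerP L m (n + 1)) => (1 : 𝔸ˣ)) hL (fun _ => 0) (fun _ => by norm_num) (perCfg_UlevOf_one_mem_U1 L m (n + 1)) (norm_Wcx_UlevOf_one_sub_one_le L m (n + 1) (fun _ => 0) (fun _ => le_rfl)) (c₁ := c₁) x‖ ≤ MQ * ‖x‖)

include ha hRS hεR hδR hδQ hMQ hRε hR hQ hQ₁

/-- **STRONG COERCIVITY AT A NEAR-FLAT BACKGROUND, FORM-RELATIVE, ALONG BAŁABAN's NORMALISATION** (`c₁(ηL)² = c₀L^d`, `0 < ηL ≤ 1`): with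
`t := ‖η⁻¹‖·εR` and the displayed `δ_R, δ_Q, M_Q`,
`(γ(d,a) − θ)·(‖D_1x‖² + ‖D*_1x‖² + ‖x‖²) ≤ re⟨x, Δ_a(U)x⟩`, `γ(d,a) = 1∕((d+1)·Cst d a)` ((S0) `flat_strong_coercive_canonical`),
`θ = 4√d·t + 16d·t² + √d·t + √d·t·δ_R + d·t² + 2δ_R + δ_R² + aδ_Q(2M_Q + δ_Q)` — §1's Kato step on §4; NO `‖η⁻¹‖²`, no volume, no block size,
no `∃`-threshold: an inequality holding for all values of the letters (useful when `θ < γ(d,a)`).  This is R2′ STEP B7′ (B7′-1)'s SHAPE for one averaging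
step, modulo the discharge of `δ_R` (S3) and of `δ_Q` at `ε = αη` (S2). [cite: Balaban1985BackgroundPropagators, Thm 3.11 p.416, (3.82)–(3.86) p.407; Balaban1984PropagatorsI, Prop. 1.1 (1.90) p.33, (1.69) p.29] -/
theorem strong_coercive_of_form_near_flat_tower_canonical (hηL0 : 0 < η * (L : ℝ) ^ (n + 1)) (hηL1 : η * (L : ℝ) ^ (n + 1) ≤ 1)
    (hs : c₁ * (η * (L : ℝ) ^ (n + 1)) ^ 2 = c₀ * ((L : ℝ) ^ (n + 1)) ^ d)
    (x : BondL2K ℂ d (towerP L m (n + 1)) c₀ W) :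
    (1 / ((d + 1 : ℝ) * B5Prop11Plancherel.Cst d a) -
        (4 * Real.sqrt d * (‖((η : ℂ))⁻¹‖ * εR) + (4 * Real.sqrt d * (‖((η : ℂ))⁻¹‖ * εR)) ^ 2 + ‖((η : ℂ))⁻¹‖ * εR * Real.sqrt d +
          ‖((η : ℂ))⁻¹‖ * εR * Real.sqrt d * δR + (‖((η : ℂ))⁻¹‖ * εR * Real.sqrt d) ^ 2 + 2 * δR + δR ^ 2 + a * δQ * (2 * MQ + δQ))) *
        (‖covCurlL2K ℂ c₀ ((η : ℂ))⁻¹ (adTransportW φ (fun _ : Bond d (towerP L m (n + 1)) => (1 : 𝔸ˣ))) x‖ ^ 2 +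
          ‖covDivL2K ℂ c₀ ((η : ℂ))⁻¹ (adTransportW φ fun _ : Bond d (towerP L m (n + 1)) => (1 : 𝔸ˣ)⁻¹) x‖ ^ 2 + ‖x‖ ^ 2) ≤
      RCLike.re ⟪x, laplaceALatticeK ((η : ℂ))⁻¹ (adTransportW φ U) (adTransportW φ fun b => (U b)⁻¹) (principalOpK φ η U) (RofUk L m n φ η U)
        (QkW L m n φ U hL α hα1 hU1 hreg (c₁ := c₁)) a x⟫_ℂ := by
  have hflat := flat_strong_coercive_tower_canonical L m n hL φ (c₁ := c₁) (fun _ => 0) (fun _ => by norm_num)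
    (perCfg_UlevOf_one_mem_U1 L m (n + 1)) (norm_Wcx_UlevOf_one_sub_one_le L m (n + 1) (fun _ => 0) (fun _ => le_rfl)) ha hηL0 hηL1 hs x
  have hnear := re_inner_laplaceAk_ge_flat_sub_of_transport L m n hL φ η ha.le U α hα1 hU1 hreg hRS hεR hδR hδQ hRε hR hQ hQ₁ x
  have hd0 : (0 : ℝ) ≤ Real.sqrt d := Real.sqrt_nonneg _
  have ht0 : 0 ≤ ‖((η : ℂ))⁻¹‖ * εR := mul_nonneg (norm_nonneg _) hεR
  have hC0 : 0 ≤ ‖covCurlL2K ℂ c₀ ((η : ℂ))⁻¹ (adTransportW φ (fun _ : Bond d (towerP L m (n + 1)) => (1 : 𝔸ˣ))) x‖ ^ 2 := sq_nonneg _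
  have hS0 : 0 ≤ ‖covDivL2K ℂ c₀ ((η : ℂ))⁻¹ (adTransportW φ fun _ : Bond d (towerP L m (n + 1)) => (1 : 𝔸ˣ)⁻¹) x‖ ^ 2 := sq_nonneg _
  have hx0 : 0 ≤ ‖x‖ ^ 2 := sq_nonneg _
  -- each row's coefficient in §4 is at most `θ`; the rest is linear bookkeeping
  nlinarith [hflat, hnear, mul_nonneg (mul_nonneg (by norm_num : (0:ℝ) ≤ 4) hd0) ht0, mul_nonneg (mul_nonneg ht0 hd0) hδR, mul_nonneg ht0 hd0,
    sq_nonneg (4 * Real.sqrt d * (‖((η : ℂ))⁻¹‖ * εR)), sq_nonneg (‖((η : ℂ))⁻¹‖ * εR * Real.sqrt d), hδR, sq_nonneg δR,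
    mul_nonneg (mul_nonneg ha.le hδQ) (by linarith : (0:ℝ) ≤ 2 * MQ + δQ),
    mul_nonneg (mul_nonneg (mul_nonneg (by norm_num : (0:ℝ) ≤ 4) hd0) ht0) hS0, mul_nonneg hδR hC0]

/-- **… HENCE THE WEAK SHAPE (C2)∕(C2′) AND `B9Ineq369CurvatureSmall.hpos_of_principal_coercive` CONSUME**: `(γ(d,a) − θ)·‖x‖² ≤ re⟨x, Δ_a(U)x⟩`
(drop the two derivative squares when `γ(d,a) − θ ≥ 0`; otherwise the left side is `≤ 0 ≤` the form, a sum of three squares by §2).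
[cite: Balaban1985BackgroundPropagators, Thm 3.11 p.416, (3.82)–(3.86) p.407; Balaban1984PropagatorsI, Prop. 1.1 (1.90) p.33] -/
theorem coercive_of_form_near_flat_tower_canonical (hηL0 : 0 < η * (L : ℝ) ^ (n + 1)) (hηL1 : η * (L : ℝ) ^ (n + 1) ≤ 1)
    (hs : c₁ * (η * (L : ℝ) ^ (n + 1)) ^ 2 = c₀ * ((L : ℝ) ^ (n + 1)) ^ d)
    (x : BondL2K ℂ d (towerP L m (n + 1)) c₀ W) :
    (1 / ((d + 1 : ℝ) * B5Prop11Plancherel.Cst d a) -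
        (4 * Real.sqrt d * (‖((η : ℂ))⁻¹‖ * εR) + (4 * Real.sqrt d * (‖((η : ℂ))⁻¹‖ * εR)) ^ 2 + ‖((η : ℂ))⁻¹‖ * εR * Real.sqrt d +
          ‖((η : ℂ))⁻¹‖ * εR * Real.sqrt d * δR + (‖((η : ℂ))⁻¹‖ * εR * Real.sqrt d) ^ 2 + 2 * δR + δR ^ 2 + a * δQ * (2 * MQ + δQ))) * ‖x‖ ^ 2 ≤
      RCLike.re ⟪x, laplaceALatticeK ((η : ℂ))⁻¹ (adTransportW φ U) (adTransportW φ fun b => (U b)⁻¹) (principalOpK φ η U) (RofUk L m n φ η U)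
        (QkW L m n φ U hL α hα1 hU1 hreg (c₁ := c₁)) a x⟫_ℂ := by
  have h := strong_coercive_of_form_near_flat_tower_canonical L m n hL φ (c₁ := c₁) ha U α hα1 hU1 hreg hRS hεR hδR hδQ hMQ hRε hR hQ hQ₁ hηL0 hηL1 hs x
  have hsq := re_inner_laplaceAk_eq_three_sq L m n hL φ (c₁ := c₁) η a U α hα1 hU1 hreg hRS x
  have hC0 : 0 ≤ ‖covCurlL2K ℂ c₀ ((η : ℂ))⁻¹ (adTransportW φ (fun _ : Bond d (towerP L m (n + 1)) => (1 : 𝔸ˣ))) x‖ ^ 2 := sq_nonneg _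
  have hS0 : 0 ≤ ‖covDivL2K ℂ c₀ ((η : ℂ))⁻¹ (adTransportW φ fun _ : Bond d (towerP L m (n + 1)) => (1 : 𝔸ˣ)⁻¹) x‖ ^ 2 := sq_nonneg _
  have hpos : 0 ≤ RCLike.re ⟪x, laplaceALatticeK ((η : ℂ))⁻¹ (adTransportW φ U) (adTransportW φ fun b => (U b)⁻¹) (principalOpK φ η U)
      (RofUk L m n φ η U) (QkW L m n φ U hL α hα1 hU1 hreg (c₁ := c₁)) a x⟫_ℂ := by
    rw [hsq]; positivity
  by_cases hγ : 0 ≤ 1 / ((d + 1 : ℝ) * B5Prop11Plancherel.Cst d a) -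
        (4 * Real.sqrt d * (‖((η : ℂ))⁻¹‖ * εR) + (4 * Real.sqrt d * (‖((η : ℂ))⁻¹‖ * εR)) ^ 2 + ‖((η : ℂ))⁻¹‖ * εR * Real.sqrt d +
          ‖((η : ℂ))⁻¹‖ * εR * Real.sqrt d * δR + (‖((η : ℂ))⁻¹‖ * εR * Real.sqrt d) ^ 2 + 2 * δR + δR ^ 2 + a * δQ * (2 * MQ + δQ))
  · exact le_trans (by nlinarith [mul_nonneg hγ hC0, mul_nonneg hγ hS0]) h
  · exact le_trans (mul_nonpos_of_nonpos_of_nonneg (le_of_not_ge hγ) (sq_nonneg _)) hpos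

end Strong

end Literature.MathematicalPhysics.QuantumFieldTheory.Balaban1983to89.B9Eq382FormRelativeNearFlatTower

end
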